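import Mathlib
import Summits.NavierStokesRegularity.NavierStokesRegularity.Theorems.EulerZoomLiouvillePowerGaugeEulerLiouvilleLastExitLateReturnsTools
import Summits.NavierStokesRegularity.NavierStokesRegularity.Theorems.EulerZoomLiouvillePowerGaugeEulerLiouvilleActionCreepMaximisers
import HarnessLib

/-!
# Line `action_creep` (ns-idea-11 g8) REV2, stub AC1′ `stub_creepingFilament`: BOUNDED VORTICAL BERNOULLI LEVELS ⇒ A CREEPING FILAMENT
# (crux `EulerZoomLiouville.PowerGaugeEulerLiouville` = stmt-NavierStokesRegularity-19832; class-free ODE lemma on `C²` profiles; width seat ns-ezl-w3 g6)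

Route №10 `EulerZoomLiouville` (NavierStokesRegularity), crux E; line `Cruxes/PowerGaugeEulerLiouville/Lines/action_creep.lean` REV2 (critic V84 P2: «the ORBIT
form of AC1»).  `(V, P′)` a `C²` profile at rate `γ = 1/(2+ρ)`, `ρ > 0`; `Mb` an upper bound of `ℋ` on the vortical set approached by vortical values.  THEN
(`ActionCreep.creepingFilament` = `Sig.stub_creepingFilament` VERBATIM): for every `δ > 0` and every `R₀` there is a GLOBAL backward similarity half-orbit `Y`
(`Y′ = −W(Y)` on `[0,∞)`, the W3b orbit shape) starting at a VORTICAL point beyond `R₀` with `ℋ > Mb − δ`, UNBOUNDED, of TOTAL ACTION `∫₀^T‖W(Y)‖² ≤ δ`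
for every `T ≥ 0`.

PROOF.  Near-maximal good label `x₁` (`ℋ(x₁) > Mb − δ′`, `δ′ = min(δ,(1−2γ)δ)/2`, off W3b's null set `Loc.volume_vortical_boundedBackward_eq_zero`).  GLOBAL ORBIT by
patching the backward flows `Arc m` of the reference cut-offs `V_m` (`Loc.exists_cutoff_local` at `m+1`): the ACTION BUDGET keeps `Arc m_n x₁` inside `‖·‖ ≤ m_n`
on `[0, n+1]` for `m_n ≥ ‖x₁‖ + n + 3 + δ` (a first exit at time `σ ≤ n+1` would be a true vortical arc of action `< δ′/(1−2γ) ≤ δ/2` and length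
`≥ m_n − ‖x₁‖`, while length `≤ ∫(1 + ‖W‖²) ≤ σ + δ/2`); consecutive arcs agree (`LastExit.eqOn_arcs_of_cutoff` under the larger cut-off) and patch to
`Y t = Arc m_{⌈t⌉} x₁ t`; `Y` is vortical with `ℋ∘Y` pinned in `(Mb − δ′, Mb]` hence of action `≤ δ/2` (`ActionCreep.bernoulli_arc`), and UNBOUNDED by the
choice of `x₁`.  SHIFT to the first time `t₀` with `‖Y t₀‖ > R₀`: `Z s = Y(t₀ + s)` is the filament.

WHAT THIS IS NOT: not NS regularity, not the crux E, not the faces AC2′/AC3 — a class-free lemma about `C²` profiles (MODEL lattice), `--supports` stmt-19832;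
19832 OPEN. [folklore; ConstantinIgnatovaVicol2026Putative §3.4.3 (3.31)]
-/

noncomputable section

-- flat `Theorems/<Route><Decl>…` files of one crux share the namespace of the crux (tree convention: `Summit.<S>.<S>.…`)
set_option linter.dupNamespace false

open Set Filter Topology Metric MeasureTheory
open scoped RealInnerProductSpace ENNReal

namespace Summit.NavierStokesRegularity.NavierStokesRegularity.Theorems.PowerGaugeEulerLiouville

namespace ActionCreep

open Literature.Analysis Literature.Analysis.FluidPDE
open ChannelClock

set_option maxHeartbeats 400000 in
/-- **AC1′ `stub_creepingFilament` OF LINE `action_creep` (REV2)** (`Sig.stub_creepingFilament` VERBATIM; Literature names, `E3` spelled out): bounded vortical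
Bernoulli levels approached by vortical values ⇒ for every `δ > 0`, `R₀` a GLOBAL backward half-orbit of `W = γy + V` starting at a vortical point beyond `R₀`
with `ℋ > Mb − δ`, unbounded, of total action `≤ δ` on every `[0, T]`.  Proof in the module docstring. [folklore] -/
theorem creepingFilament :
    ∀ ρ : ℝ, 0 < ρ →
    ∀ (V : EuclideanSpace ℝ (Fin 3) → EuclideanSpace ℝ (Fin 3)) (P' : EuclideanSpace ℝ (Fin 3) → ℝ),
      IsSelfSimilarEulerProfile (1 / (2 + ρ)) 0 V P' →
      ∀ Mb : ℝ,
        (∀ y : EuclideanSpace ℝ (Fin 3), curl V y ≠ 0 → selfSimilarBernoulli (1 / (2 + ρ)) 0 V P' y ≤ Mb) →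
        (∀ δ : ℝ, 0 < δ → ∃ x : EuclideanSpace ℝ (Fin 3), curl V x ≠ 0 ∧
            Mb - δ < selfSimilarBernoulli (1 / (2 + ρ)) 0 V P' x) →
        ∀ δ : ℝ, 0 < δ → ∀ R₀ : ℝ, ∃ Y : ℝ → EuclideanSpace ℝ (Fin 3),
          (∀ t : ℝ, 0 ≤ t → HasDerivAt Y ((-1 : ℝ) • selfSimilarTransport (1 / (2 + ρ)) 0 V (Y t)) t) ∧
          R₀ ≤ ‖Y 0‖ ∧ curl V (Y 0) ≠ 0 ∧
          Mb - δ < selfSimilarBernoulli (1 / (2 + ρ)) 0 V P' (Y 0) ∧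
          (∀ N : ℝ, ∃ t : ℝ, 0 ≤ t ∧ N < ‖Y t‖) ∧
          (∀ T : ℝ, 0 ≤ T → ∫ t in (0 : ℝ)..T, ‖selfSimilarTransport (1 / (2 + ρ)) 0 V (Y t)‖ ^ 2 ≤ δ) := by
  intro ρ hρ V P' hprof Mb hMb happ δ hδ R₀
  set γ : ℝ := 1 / (2 + ρ) with hγdef
  have h2ρ : (0 : ℝ) < 2 + ρ := by linarith
  have hγ : 0 < γ := one_div_pos.2 h2ρ
  have hγ2 : γ < 1 / 2 := one_div_lt_one_div_of_lt two_pos (by linarith)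
  have h12 : 0 < 1 - 2 * γ := by linarith
  set W : EuclideanSpace ℝ (Fin 3) → EuclideanSpace ℝ (Fin 3) := selfSimilarTransport γ 0 V with hWdef
  set ℋ : EuclideanSpace ℝ (Fin 3) → ℝ := selfSimilarBernoulli γ 0 V P' with hHdef
  have hU2 : ContDiff ℝ 2 V := hprof.contDiff_velocity
  have hWc : Continuous W := by
    have e : W = fun y => γ • (y - 0) + V y := rfl
    rw [e]; exact ((continuous_id.sub continuous_const).const_smul γ).add hU2.continuous
  have hHc : Continuous ℋ := hprof.contDiff_selfSimilarBernoulli.continuous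
  have hcurlc : Continuous (curl V) := (differentiable_curl_of_contDiff hU2).continuous
  -- pointwise `a ≤ 1 + a²`
  have hlin : ∀ z : EuclideanSpace ℝ (Fin 3), ‖W z‖ ≤ 1 + ‖W z‖ ^ 2 := fun z => by nlinarith [sq_nonneg (‖W z‖ - 1), norm_nonneg (W z)]
  -- ### tolerance and the near-maximal good label
  set δ' : ℝ := min δ ((1 - 2 * γ) * δ) / 2 with hδ'def
  have hδ' : 0 < δ' := by rw [hδ'def]; exact div_pos (lt_min hδ (mul_pos h12 hδ)) two_pos
  have hδ'δ : δ' ≤ δ / 2 := by rw [hδ'def]; linarith [min_le_left δ ((1 - 2 * γ) * δ)]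
  have hδ'2 : δ' ≤ (1 - 2 * γ) * δ / 2 := by rw [hδ'def]; linarith [min_le_right δ ((1 - 2 * γ) * δ)]
  obtain ⟨x, hxc, hxH⟩ := happ δ' hδ'
  set O : Set (EuclideanSpace ℝ (Fin 3)) := {z | curl V z ≠ 0 ∧ Mb - δ' < ℋ z} with hOdef
  have hOopen : IsOpen O := (isOpen_ne_fun hcurlc continuous_const).inter (isOpen_lt continuous_const hHc)
  have hOpos : 0 < volume O := hOopen.measure_pos volume ⟨x, hxc, hxH⟩
  have hnull := Loc.volume_vortical_boundedBackward_eq_zero hprof hγ hγ2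
  obtain ⟨x₁, ⟨hx₁c, hx₁H⟩, hx₁good⟩ : ∃ z ∈ O, z ∉ {x : EuclideanSpace ℝ (Fin 3) | curl V x ≠ 0 ∧
      ∃ Y : ℝ → EuclideanSpace ℝ (Fin 3), Y 0 = x ∧
        (∀ t, 0 ≤ t → HasDerivAt Y ((-1 : ℝ) • selfSimilarTransport γ 0 V (Y t)) t) ∧
        ∃ N : ℝ, ∀ t, 0 ≤ t → ‖Y t‖ ≤ N} := by
    by_contra hcon
    push Not at hcon
    have hle := measure_mono (μ := volume) (show O ⊆ _ from fun z hz => hcon z hz)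
    rw [hnull] at hle
    exact absurd (le_antisymm hle bot_le) hOpos.ne'
  -- ### reference cut-offs and their backward flows
  have hcut : ∀ m : ℕ, ∃ Vm : EuclideanSpace ℝ (Fin 3) → EuclideanSpace ℝ (Fin 3), ∃ Km : ℝ,
      ContDiff ℝ 2 Vm ∧ (∀ y, ‖fderiv ℝ Vm y‖ ≤ Km) ∧ ∀ y ∈ ball (0 : EuclideanSpace ℝ (Fin 3)) ((m : ℝ) + 1), Vm y = V y := by
    intro m
    obtain ⟨Vm, hVm, -, -, ⟨Km, hKm⟩, hag⟩ := Loc.exists_cutoff_local hU2 (R := (m : ℝ) + 1) (by positivity)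
    exact ⟨Vm, Km, hVm, hKm, hag⟩
  choose Vc Kc hVc hKc hagc using hcut
  have hVc1 : ∀ m, ContDiff ℝ 1 (Vc m) := fun m => (hVc m).of_le (by norm_num)
  have hWm_eq : ∀ (m : ℕ) (z : EuclideanSpace ℝ (Fin 3)), ‖z‖ < (m : ℝ) + 1 → selfSimilarTransport γ 0 (Vc m) z = W z := by
    intro m z hz
    simp only [hWdef, selfSimilarTransport_apply, hagc m z (by rwa [mem_ball, dist_zero_right])]
  set Arc : ℕ → ℝ → EuclideanSpace ℝ (Fin 3) := fun m t =>
    ODE.evolutionMap (fun _ : ℝ => selfSimilarTransport γ 0 (Vc m)) 0 (-t) x₁ with hArcdef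
  have hArc_d : ∀ m t, HasDerivAt (Arc m) ((-1 : ℝ) • selfSimilarTransport γ 0 (Vc m) (Arc m t)) t :=
    fun m t => C2.Kelvin.hasDerivAt_flow_neg (γ := γ) (hVc1 m) (hKc m) x₁ t
  have hArc_self : ∀ m t, HasDerivAt (Arc m) (-(selfSimilarTransport γ 0 (Vc m) (Arc m t))) t := fun m t => by
    have hd := hArc_d m t
    rwa [neg_one_smul] at hd
  have hArc0 : ∀ m, Arc m 0 = x₁ := by intro m; simp [hArcdef, ODE.evolutionMap_self]
  have hArcc : ∀ m, Continuous (Arc m) := fun m => continuous_iff_continuousAt.2 fun t => (hArc_d m t).continuousAt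
  have hArc_true : ∀ (m : ℕ) (σ : ℝ), (∀ s ∈ Icc 0 σ, ‖Arc m s‖ ≤ (m : ℝ)) →
      ∀ s ∈ Icc 0 σ, HasDerivAt (Arc m) (-(W (Arc m s))) s := by
    intro m σ hstay s hs
    have hd := hArc_self m s
    rw [hWm_eq m _ (by linarith [hstay s hs])] at hd
    exact hd
  -- ### the action budget keeps `Arc (mI n)` inside `‖·‖ ≤ mI n` on `[0, n+1]`
  set mI : ℕ → ℕ := fun n => ⌈‖x₁‖ + (n : ℝ) + 3 + δ⌉₊ with hmIdef
  have hmI : ∀ n : ℕ, ‖x₁‖ + (n : ℝ) + 3 + δ ≤ (mI n : ℝ) := fun n => Nat.le_ceil _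
  have hstay : ∀ n : ℕ, ∀ s ∈ Icc (0 : ℝ) ((n : ℝ) + 1), ‖Arc (mI n) s‖ ≤ (mI n : ℝ) := by
    intro n
    by_contra hcon
    push Not at hcon
    obtain ⟨s₀, hs₀, hbig⟩ := hcon
    have hlt0 : (fun t => ‖Arc (mI n) t‖) 0 < (mI n : ℝ) := by
      show ‖Arc (mI n) 0‖ < (mI n : ℝ)
      rw [hArc0]; linarith [hmI n, hδ]
    obtain ⟨σ₁, hσ₁pos, hσ₁le, hhit, hinside⟩ :=
      exists_first_hit (f := fun t => ‖Arc (mI n) t‖) hs₀.1 (hArcc (mI n)).norm.continuousOn hlt0 hbig.le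
    have htrue : ∀ s ∈ Icc 0 σ₁, HasDerivAt (Arc (mI n)) (-(W (Arc (mI n) s))) s := hArc_true (mI n) σ₁ hinside
    have hvort : curl V (Arc (mI n) σ₁) ≠ 0 :=
      curl_ne_zero_of_arc hprof hσ₁pos.le htrue (by rw [hArc0]; exact hx₁c)
    -- action on `[0, σ₁]`
    have hact : ∫ t in (0 : ℝ)..σ₁, ‖W (Arc (mI n) t)‖ ^ 2 ≤ δ / 2 := by
      have e := bernoulli_arc hprof htrue le_rfl hσ₁pos.le le_rfl
      have h1 : ℋ (Arc (mI n) σ₁) ≤ Mb := hMb _ hvort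
      have h2 : Mb - δ' < ℋ (Arc (mI n) 0) := by rw [hArc0]; exact hx₁H
      have h3 : (1 - 2 * γ) * ∫ t in (0 : ℝ)..σ₁, ‖W (Arc (mI n) t)‖ ^ 2 < δ' := by rw [hWdef, ← e]; linarith
      by_contra h4
      push Not at h4
      have := mul_lt_mul_of_pos_left h4 h12
      nlinarith
    -- length on `[0, σ₁]`: `mI n − ‖x₁‖ ≤ ∫‖W‖ ≤ σ₁ + action`
    have hWYc : Continuous fun t => ‖W (Arc (mI n) t)‖ := (hWc.comp (hArcc (mI n))).norm
    have hftc : ∫ t in (0 : ℝ)..σ₁, -(W (Arc (mI n) t)) = Arc (mI n) σ₁ - Arc (mI n) 0 :=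
      intervalIntegral.integral_eq_sub_of_hasDerivAt
        (fun t ht => by rw [uIcc_of_le hσ₁pos.le] at ht; exact htrue t ht)
        ((hWc.comp (hArcc (mI n))).neg.intervalIntegrable _ _)
    have hlen : ‖Arc (mI n) σ₁ - Arc (mI n) 0‖ ≤ ∫ t in (0 : ℝ)..σ₁, ‖W (Arc (mI n) t)‖ := by
      rw [← hftc]
      have := intervalIntegral.norm_integral_le_integral_norm (f := fun t => -(W (Arc (mI n) t))) hσ₁pos.le (μ := volume)
      simpa only [norm_neg] using this
    have hlen2 : ∫ t in (0 : ℝ)..σ₁, ‖W (Arc (mI n) t)‖ ≤ ∫ t in (0 : ℝ)..σ₁, (1 + ‖W (Arc (mI n) t)‖ ^ 2) :=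
      intervalIntegral.integral_mono_on hσ₁pos.le (hWYc.intervalIntegrable _ _)
        ((continuous_const.add (hWYc.pow 2)).intervalIntegrable _ _) fun t _ => hlin _
    have hsplit : ∫ t in (0 : ℝ)..σ₁, (1 + ‖W (Arc (mI n) t)‖ ^ 2) = σ₁ + ∫ t in (0 : ℝ)..σ₁, ‖W (Arc (mI n) t)‖ ^ 2 := by
      have h1 := intervalIntegral.integral_add (a := (0 : ℝ)) (b := σ₁) (μ := volume)
        (intervalIntegrable_const (c := (1 : ℝ))) ((hWYc.pow 2).intervalIntegrable (0 : ℝ) σ₁)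
      have h2 : ∫ _ in (0 : ℝ)..σ₁, (1 : ℝ) = σ₁ := by simp
      rw [h2] at h1
      simpa [Pi.pow_apply] using h1
    have hdist : (mI n : ℝ) - ‖x₁‖ ≤ ‖Arc (mI n) σ₁ - Arc (mI n) 0‖ := by
      rw [hArc0]
      have h1 : ‖Arc (mI n) σ₁‖ - ‖x₁‖ ≤ ‖Arc (mI n) σ₁ - x₁‖ := norm_sub_norm_le _ _
      have h2 : ‖Arc (mI n) σ₁‖ = (mI n : ℝ) := hhit
      linarith
    have hσ₁n : σ₁ ≤ (n : ℝ) + 1 := hσ₁le.trans hs₀.2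
    linarith [hmI n]
  -- ### Claim A: the arcs agree on common intervals (uniqueness under the larger cut-off)
  have hsolve : ∀ i j : ℕ, mI i ≤ mI j → ∀ s ∈ Icc (0 : ℝ) ((i : ℝ) + 1),
      HasDerivAt (Arc (mI i)) (-(selfSimilarTransport γ 0 (Vc (mI j)) (Arc (mI i) s))) s := by
    intro i j hij s hs
    have hd := hArc_true (mI i) ((i : ℝ) + 1) (hstay i) s hs
    have hcast : ((mI i : ℕ) : ℝ) ≤ ((mI j : ℕ) : ℝ) := by exact_mod_cast hij
    rw [← hWm_eq (mI j) _ (by linarith [hstay i s hs])] at hd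
    exact hd
  have hagree : ∀ i j : ℕ, ∀ s ∈ Icc (0 : ℝ) (min ((i : ℝ) + 1) ((j : ℝ) + 1)), Arc (mI i) s = Arc (mI j) s := by
    intro i j s hs
    rcases le_total (mI i) (mI j) with hij | hji
    · exact LastExit.eqOn_arcs_of_cutoff (hVc1 (mI j)) (hKc (mI j)) (σ := min ((i : ℝ) + 1) ((j : ℝ) + 1))
        (fun s hs => hsolve i j hij s ⟨hs.1, hs.2.trans (min_le_left _ _)⟩) (fun s _ => hArc_self (mI j) s)
        (by rw [hArc0, hArc0]) hs
    · exact LastExit.eqOn_arcs_of_cutoff (hVc1 (mI i)) (hKc (mI i)) (σ := min ((i : ℝ) + 1) ((j : ℝ) + 1))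
        (fun s _ => hArc_self (mI i) s) (fun s hs => hsolve j i hji s ⟨hs.1, hs.2.trans (min_le_right _ _)⟩)
        (by rw [hArc0, hArc0]) hs
  -- ### the patched global orbit
  set Y : ℝ → EuclideanSpace ℝ (Fin 3) := fun t => Arc (mI ⌈t⌉₊) t with hYdef
  have hYeq : ∀ (n : ℕ) (s : ℝ), 0 ≤ s → s < (n : ℝ) + 1 → Y s = Arc (mI n) s := by
    intro n s hs0 hsn
    show Arc (mI ⌈s⌉₊) s = Arc (mI n) s
    refine hagree ⌈s⌉₊ n s ⟨hs0, le_min ?_ hsn.le⟩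
    have h2 : s ≤ (⌈s⌉₊ : ℝ) := Nat.le_ceil s
    linarith
  have hY0 : Y 0 = x₁ := by rw [hYeq 0 0 le_rfl (by norm_num), hArc0]
  have hYd : ∀ t : ℝ, 0 ≤ t → HasDerivAt Y ((-1 : ℝ) • selfSimilarTransport γ 0 V (Y t)) t := by
    intro t ht
    set n : ℕ := ⌈t⌉₊ with hndef
    have htn : t ≤ (n : ℝ) := Nat.le_ceil t
    have hev : Y =ᶠ[𝓝 t] Arc (mI n) := by
      rcases eq_or_lt_of_le ht with h0 | hpos
      · have hn0 : n = 0 := by rw [hndef, ← h0]; simp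
        filter_upwards [Iio_mem_nhds (show t < (n : ℝ) + 1 by linarith)] with s hs
        by_cases hs0 : 0 ≤ s
        · exact hYeq n s hs0 hs
        · push Not at hs0
          show Arc (mI ⌈s⌉₊) s = Arc (mI n) s
          rw [Nat.ceil_eq_zero.2 hs0.le, hn0]
      · filter_upwards [Ioo_mem_nhds hpos (show t < (n : ℝ) + 1 by linarith)] with s hs
        exact hYeq n s hs.1.le hs.2
    have hd := hArc_d (mI n) t
    have htI : t ∈ Icc (0 : ℝ) ((n : ℝ) + 1) := ⟨ht, by linarith⟩
    rw [hWm_eq (mI n) _ (by linarith [hstay n t htI])] at hd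
    have hYt : Y t = Arc (mI n) t := hYeq n t ht (by linarith)
    rw [← hYt] at hd
    exact hd.congr_of_eventuallyEq hev
  have hYarc : ∀ B : ℝ, ∀ s ∈ Icc 0 B, HasDerivAt Y (-(W (Y s))) s := fun B s hs => by
    have hd := hYd s hs.1
    rwa [neg_one_smul] at hd
  have hYvort : ∀ t, 0 ≤ t → curl V (Y t) ≠ 0 := fun t ht =>
    curl_ne_zero_of_arc hprof ht (hYarc t) (by rw [hY0]; exact hx₁c)
  have hYmono : ∀ a b : ℝ, 0 ≤ a → a ≤ b → ℋ (Y a) ≤ ℋ (Y b) := by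
    intro a b ha hab
    have e := bernoulli_arc hprof (hYarc b) ha hab le_rfl
    have hI : 0 ≤ ∫ s in a..b, ‖selfSimilarTransport γ 0 V (Y s)‖ ^ 2 :=
      intervalIntegral.integral_nonneg hab fun s _ => sq_nonneg _
    have : 0 ≤ ℋ (Y b) - ℋ (Y a) := by rw [hHdef, e]; exact mul_nonneg h12.le hI
    linarith
  have hYact : ∀ T : ℝ, 0 ≤ T → ∫ t in (0 : ℝ)..T, ‖W (Y t)‖ ^ 2 ≤ δ / 2 := by
    intro T hT
    have e := bernoulli_arc hprof (hYarc T) le_rfl hT le_rfl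
    have h1 : ℋ (Y T) ≤ Mb := hMb _ (hYvort T hT)
    have h2 : Mb - δ' < ℋ (Y 0) := by rw [hY0]; exact hx₁H
    have h3 : (1 - 2 * γ) * ∫ t in (0 : ℝ)..T, ‖W (Y t)‖ ^ 2 < δ' := by rw [hWdef, ← e]; linarith
    by_contra h4
    push Not at h4
    have := mul_lt_mul_of_pos_left h4 h12
    nlinarith
  have hYunb : ∀ N : ℝ, ∃ t : ℝ, 0 ≤ t ∧ N < ‖Y t‖ := by
    by_contra hcon
    push Not at hcon
    obtain ⟨N, hN⟩ := hcon
    exact hx₁good ⟨hx₁c, Y, hY0, hYd, N, hN⟩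
  -- ### shift to the first far time
  obtain ⟨t₀, ht₀, hfar⟩ := hYunb R₀
  set Z : ℝ → EuclideanSpace ℝ (Fin 3) := fun s => Y (t₀ + s) with hZdef
  have hZd : ∀ s : ℝ, 0 ≤ s → HasDerivAt Z ((-1 : ℝ) • selfSimilarTransport γ 0 V (Z s)) s := by
    intro s hs
    have hd := hYd (t₀ + s) (by linarith)
    exact hd.comp_const_add t₀ s
  have hYcOn : ∀ a b : ℝ, 0 ≤ a → ContinuousOn Y (Icc a b) := fun a b ha t ht =>
    ((hYd t (ha.trans ht.1)).continuousAt).continuousWithinAt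
  have hZ0 : Z 0 = Y t₀ := by simp [hZdef]
  refine ⟨Z, hZd, by rw [hZ0]; exact hfar.le, by rw [hZ0]; exact hYvort t₀ ht₀, ?_, ?_, ?_⟩
  · have h1 := hYmono 0 t₀ le_rfl ht₀
    rw [hY0] at h1
    rw [hZ0]
    show Mb - δ < ℋ (Y t₀)
    linarith [hx₁H]
  · intro N
    obtain ⟨M₀, hM₀⟩ := (isCompact_Icc (a := (0 : ℝ)) (b := t₀)).exists_bound_of_continuousOn (hYcOn 0 t₀ le_rfl)
    obtain ⟨t, ht, hNt⟩ := hYunb (max N M₀)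
    have htt₀ : t₀ < t := by
      by_contra hle
      push Not at hle
      have h1 : ‖Y t‖ ≤ M₀ := hM₀ t ⟨ht, hle⟩
      linarith [le_max_right N M₀]
    refine ⟨t - t₀, by linarith, ?_⟩
    show N < ‖Y (t₀ + (t - t₀))‖
    rw [add_sub_cancel]
    linarith [le_max_left N M₀]
  · intro T hT
    have e : ∫ s in (0 : ℝ)..T, ‖selfSimilarTransport γ 0 V (Z s)‖ ^ 2 =
        ∫ t in t₀..t₀ + T, ‖W (Y t)‖ ^ 2 := by
      simp only [hZdef, hWdef]
      rw [intervalIntegral.integral_comp_add_left (fun t => ‖selfSimilarTransport γ 0 V (Y t)‖ ^ 2) t₀, add_zero]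
    rw [e]
    have hcont : ContinuousOn (fun t => ‖W (Y t)‖ ^ 2) (uIcc 0 (t₀ + T)) := by
      rw [uIcc_of_le (by linarith)]; exact ((hWc.comp_continuousOn (hYcOn 0 (t₀ + T) le_rfl)).norm).pow 2
    have hsub : ∫ t in t₀..t₀ + T, ‖W (Y t)‖ ^ 2 ≤ ∫ t in (0 : ℝ)..(t₀ + T), ‖W (Y t)‖ ^ 2 :=
      intervalIntegral.integral_mono_interval ht₀ (by linarith) le_rfl
        (Eventually.of_forall fun t => sq_nonneg _) hcont.intervalIntegrable
    linarith [hYact (t₀ + T) (by linarith)]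

end ActionCreep

end Summit.NavierStokesRegularity.NavierStokesRegularity.Theorems.PowerGaugeEulerLiouville

end
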